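import Summits.QuantumFields.YangMills.Theses.SwapVirialDeficit
import Summits.QuantumFields.YangMills.Theorems.VirialFluxGapSectorWeightSmooth
import Summits.QuantumFields.YangMills.Theorems.SwapTwistTraceDefs
import HarnessLib

/-!
# `SwapVirialDeficit.RingTraceSmooth` (item stmt-QuantumFields-24135): the zero-flux ring trace `b ↦ Z_phys(L,b,T)` and the swap-twisted ring
# trace `b ↦ Z^S(L,b,T)` are differentiable and strictly positive in the coupling

Support item (S) of route `SwapVirialDeficit` (seat ym-idea-4, LINE g14-B, DRAFT by design → `SwapTwistDeficit.TwistDeficitLaplaceWindow` ⟨23776⟩).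

Mechanism (calculus bookkeeping, same as the companion ✓`VirialFluxGapSectorWeightSmooth` for ⟨24143⟩): `Z_phys = (1/8) Σ_z W_z`
(✓`TT.physTraceSucc_eq_sum_sectorWeight`, ym-dw-p1), each `W_z(b) = ∫ e^{bΦ_z}` differentiable and positive (`differentiable_sectorWeight_one`,
`sectorWeight_one_pos`); for `Z^S` the same unfolding of the physical average with the axis exchange `σ = configPerm (swap 0 1)` on the seam slice
(§1, one Fubini: `Z^S = (1/8) Σ_z ∫ ∏K_b · K_b(U_n, g·tw_z σU_0) d(slices ⊗ seam field)`), each term an exponential tilt `∫ e^{bΦ'_z}` of the bounded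
measurable exponent `Φ'_z = log(chain at b = 1)`, hence differentiable (dominated differentiation, `hasDerivAt_integral_exp_mul`) and `> 0`.

HONEST FRAMING: an S support; the cruxes `ToronSoftnessSharp` ⟨24133⟩ / `SwapGluedStiffness` ⟨24134⟩ are NOT touched; no rung / summit statement is
proved; the YM mass gap is NOT proved (width seat ym-line-sfw-p2-w3 g35 of cell ym-idea-1, free hands).  THEOREMS ONLY (0 `def`, 0 `sorry`), standard
axioms.  References: [cite: MontvayMunster1994, (3.145)]; [cite: tHooft1979]; [cite: Luscher1983, §2].
-/

set_option autoImplicit false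

noncomputable section

open MeasureTheory Filter Set Function
open scoped BigOperators Topology
open Literature.MathematicalPhysics.QuantumFieldTheory hiding SU2

namespace Summit.QuantumFields.YangMills.Theorems.FemtoTransferGap.TT.SectorSmooth

open Summit.QuantumFields.YangMills.Theorems.FemtoTransferGap
open Summit.QuantumFields.YangMills.Theorems.FemtoTransferGap.TT
open Summit.QuantumFields.YangMills.Theorems.FemtoTransferGap.TwoLattice.TowerA (abs_seamWeight_le)

variable {L : ℕ} [NeZero L]

/-! ## §1 The swap-twisted ring trace with the seam field outermost (one Fubini) -/

/-- Joint measurability of the swap-seamed chain `(Us, g) ↦ ∏_{i<n} K_b(U_i,U_{i+1}) · K_b(U_n, g·tw_z σU_0)`. [folklore] -/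
theorem measurable_swapSeamChain (b : ℝ) (n : ℕ) (z : Fin 3 → Bool) :
    Measurable fun p : (Fin (n + 1) → GaugeConfig 3 L SU2) × (Site 3 L → SU2) =>
      (∏ i : Fin n, transferKernel su2Rep b (p.1 i.castSucc) (p.1 i.succ)) *
        transferKernel su2Rep b (p.1 (Fin.last n)) (gaugeTransform p.2 (twist3 z (configPerm (Equiv.swap (0 : Fin 3) 1) (p.1 0)))) := by
  have hK : Measurable (fun q : GaugeConfig 3 L SU2 × GaugeConfig 3 L SU2 => transferKernel su2Rep b q.1 q.2) :=
    (PhysL2.stronglyMeasurable_transferKernel (L := L) b).measurable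
  have hG : Measurable (fun q : (Site 3 L → SU2) × GaugeConfig 3 L SU2 => gaugeTransform q.1 q.2) :=
    measurable_gaugeTransform_uncurry (L := L)
  have hT : Measurable (twist3 (L := L) z) := measurable_twist3 z
  have hS : Measurable (configPerm (L := L) (G := SU2) (Equiv.swap (0 : Fin 3) 1)) := (configPerm _).measurable
  fun_prop

/-- ★ **`Z^S` with the seam field outermost**: `twistTraceSucc L b n = (1/8) Σ_z ∫ ∏_{i<n} K_b(U_i,U_{i+1}) · K_b(U_n, g·tw_z σU_0) d(slices ⊗ seam field)`
(the physical average unfolded on the swapped seam slice; one Fubini). [cite: tHooft1979] [cite: MontvayMunster1994, (3.145)] -/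
theorem twistTraceSucc_eq_sum_integral_prod (b : ℝ) (n : ℕ) :
    twistTraceSucc L b n = (1 / 8 : ℝ) * ∑ z : Fin 3 → Bool,
      ∫ p : (Fin (n + 1) → GaugeConfig 3 L SU2) × (Site 3 L → SU2),
        (∏ i : Fin n, transferKernel su2Rep b (p.1 i.castSucc) (p.1 i.succ)) *
          transferKernel su2Rep b (p.1 (Fin.last n)) (gaugeTransform p.2 (twist3 z (configPerm (Equiv.swap (0 : Fin 3) 1) (p.1 0))))
        ∂((Measure.pi fun _ : Fin (n + 1) => configMeasure SU2 L).prod (gaugeMeasure L)) := by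
  haveI := isProbabilityMeasure_gaugeMeasure (L := L)
  obtain ⟨M, hM0, hM⟩ := PhysL2.exists_norm_transferKernel_le (L := L) b
  -- pointwise: pull the product inside the average
  have hpt : ∀ Us : Fin (n + 1) → GaugeConfig 3 L SU2,
      (∏ i : Fin n, transferKernel su2Rep b (Us i.castSucc) (Us i.succ)) *
          physAvg (transferKernel su2Rep b (Us (Fin.last n))) (configPerm (Equiv.swap (0 : Fin 3) 1) (Us 0)) =
        (1 / 8 : ℝ) * ∑ z : Fin 3 → Bool, ∫ g,
          (∏ i : Fin n, transferKernel su2Rep b (Us i.castSucc) (Us i.succ)) *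
            transferKernel su2Rep b (Us (Fin.last n)) (gaugeTransform g (twist3 z (configPerm (Equiv.swap (0 : Fin 3) 1) (Us 0))))
            ∂gaugeMeasure L := by
    intro Us
    unfold physAvg
    rw [mul_left_comm, Finset.mul_sum]
    congr 1
    refine Finset.sum_congr rfl fun z _ => ?_
    rw [← integral_const_mul]
  -- integrability on the product space
  have hint : ∀ z : Fin 3 → Bool, Integrable (fun p : (Fin (n + 1) → GaugeConfig 3 L SU2) × (Site 3 L → SU2) =>
      (∏ i : Fin n, transferKernel su2Rep b (p.1 i.castSucc) (p.1 i.succ)) *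
        transferKernel su2Rep b (p.1 (Fin.last n)) (gaugeTransform p.2 (twist3 z (configPerm (Equiv.swap (0 : Fin 3) 1) (p.1 0)))))
      ((Measure.pi fun _ : Fin (n + 1) => configMeasure SU2 L).prod (gaugeMeasure L)) := by
    intro z
    refine Integrable.of_bound (measurable_swapSeamChain b n z).aestronglyMeasurable (M ^ n * M) (ae_of_all _ fun p => ?_)
    exact abs_seamWeight_le hM0 hM p.1 _
  unfold twistTraceSucc
  simp_rw [hpt]
  rw [integral_const_mul, integral_finsetSum _ fun z _ => (hint z).integral_prod_left]
  congr 1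
  refine Finset.sum_congr rfl fun z _ => ?_
  rw [integral_prod _ (hint z)]

/-! ## §2 Each swap-seamed sector term is an exponential tilt: differentiability and positivity -/

/-- The logarithm of the swap-seamed chain at `b = 1` is the sum of the link-pair exponents. [folklore] -/
theorem log_swapSeamChain_one (n : ℕ) (z : Fin 3 → Bool) (p : (Fin (n + 1) → GaugeConfig 3 L SU2) × (Site 3 L → SU2)) :
    Real.log ((∏ i : Fin n, transferKernel su2Rep 1 (p.1 i.castSucc) (p.1 i.succ)) *
        transferKernel su2Rep 1 (p.1 (Fin.last n)) (gaugeTransform p.2 (twist3 z (configPerm (Equiv.swap (0 : Fin 3) 1) (p.1 0))))) =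
      (∑ i : Fin n, Real.log (transferKernel su2Rep 1 (p.1 i.castSucc) (p.1 i.succ))) +
        Real.log (transferKernel su2Rep 1 (p.1 (Fin.last n)) (gaugeTransform p.2 (twist3 z (configPerm (Equiv.swap (0 : Fin 3) 1) (p.1 0))))) := by
  rw [Real.log_mul (Finset.prod_pos fun i _ => transferKernel_pos su2Rep (1 : ℝ) _ _).ne' (transferKernel_pos su2Rep (1 : ℝ) _ _).ne',
    Real.log_prod fun i _ => (transferKernel_pos su2Rep (1 : ℝ) _ _).ne']

/-- The swap-seamed chain at coupling `b` is the exponential tilt `exp(b · log(chain at 1))`. [folklore] -/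
theorem swapSeamChain_eq_exp (b : ℝ) (n : ℕ) (z : Fin 3 → Bool) (p : (Fin (n + 1) → GaugeConfig 3 L SU2) × (Site 3 L → SU2)) :
    (∏ i : Fin n, transferKernel su2Rep b (p.1 i.castSucc) (p.1 i.succ)) *
        transferKernel su2Rep b (p.1 (Fin.last n)) (gaugeTransform p.2 (twist3 z (configPerm (Equiv.swap (0 : Fin 3) 1) (p.1 0)))) =
      Real.exp (b * Real.log ((∏ i : Fin n, transferKernel su2Rep 1 (p.1 i.castSucc) (p.1 i.succ)) *
        transferKernel su2Rep 1 (p.1 (Fin.last n)) (gaugeTransform p.2 (twist3 z (configPerm (Equiv.swap (0 : Fin 3) 1) (p.1 0)))))) := by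
  rw [log_swapSeamChain_one, mul_add, Real.exp_add, Finset.mul_sum, Real.exp_sum]
  congr 1
  · exact Finset.prod_congr rfl fun i _ => transferKernel_eq_exp_mul_log b _ _
  · exact transferKernel_eq_exp_mul_log b _ _

/-- The swap-seamed exponent is bounded. [folklore] -/
theorem exists_abs_log_swapSeamChain_one_le (n : ℕ) (z : Fin 3 → Bool) :
    ∃ B : ℝ, ∀ p : (Fin (n + 1) → GaugeConfig 3 L SU2) × (Site 3 L → SU2),
      |Real.log ((∏ i : Fin n, transferKernel su2Rep 1 (p.1 i.castSucc) (p.1 i.succ)) *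
        transferKernel su2Rep 1 (p.1 (Fin.last n)) (gaugeTransform p.2 (twist3 z (configPerm (Equiv.swap (0 : Fin 3) 1) (p.1 0)))))| ≤ B := by
  obtain ⟨B, hB⟩ := exists_abs_log_transferKernel_one_le (L := L)
  refine ⟨n * B + B, fun p => ?_⟩
  rw [log_swapSeamChain_one]
  refine (abs_add_le _ _).trans (add_le_add ?_ (hB _ _))
  calc |∑ i : Fin n, Real.log (transferKernel su2Rep 1 (p.1 i.castSucc) (p.1 i.succ))|
      ≤ ∑ i : Fin n, |Real.log (transferKernel su2Rep 1 (p.1 i.castSucc) (p.1 i.succ))| := Finset.abs_sum_le_sum_abs _ _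
    _ ≤ ∑ _i : Fin n, B := Finset.sum_le_sum fun i _ => hB _ _
    _ = n * B := by rw [Finset.sum_const, Finset.card_univ, Fintype.card_fin, nsmul_eq_mul]

/-- ★ **`Z^S` is differentiable in the coupling.** [cite: tHooft1979] [cite: MontvayMunster1994, (3.145)] -/
theorem differentiable_twistTraceSucc (n : ℕ) : Differentiable ℝ (fun b : ℝ => twistTraceSucc L b n) := by
  haveI := isProbabilityMeasure_gaugeMeasure (L := L)
  have hterm : ∀ z : Fin 3 → Bool, Differentiable ℝ (fun b : ℝ =>
      ∫ p : (Fin (n + 1) → GaugeConfig 3 L SU2) × (Site 3 L → SU2),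
        (∏ i : Fin n, transferKernel su2Rep b (p.1 i.castSucc) (p.1 i.succ)) *
          transferKernel su2Rep b (p.1 (Fin.last n)) (gaugeTransform p.2 (twist3 z (configPerm (Equiv.swap (0 : Fin 3) 1) (p.1 0))))
        ∂((Measure.pi fun _ : Fin (n + 1) => configMeasure SU2 L).prod (gaugeMeasure L))) := by
    intro z
    obtain ⟨B, hB⟩ := exists_abs_log_swapSeamChain_one_le (L := L) n z
    have h := differentiable_integral_exp_mul ((Measure.pi fun _ : Fin (n + 1) => configMeasure SU2 L).prod (gaugeMeasure L))
      (measurable_swapSeamChain (L := L) 1 n z).log hB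
    have hfun' : (fun b : ℝ =>
        ∫ p : (Fin (n + 1) → GaugeConfig 3 L SU2) × (Site 3 L → SU2),
          (∏ i : Fin n, transferKernel su2Rep b (p.1 i.castSucc) (p.1 i.succ)) *
            transferKernel su2Rep b (p.1 (Fin.last n)) (gaugeTransform p.2 (twist3 z (configPerm (Equiv.swap (0 : Fin 3) 1) (p.1 0))))
          ∂((Measure.pi fun _ : Fin (n + 1) => configMeasure SU2 L).prod (gaugeMeasure L))) =
        fun b : ℝ => ∫ p : (Fin (n + 1) → GaugeConfig 3 L SU2) × (Site 3 L → SU2),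
          Real.exp (b * Real.log ((∏ i : Fin n, transferKernel su2Rep 1 (p.1 i.castSucc) (p.1 i.succ)) *
            transferKernel su2Rep 1 (p.1 (Fin.last n)) (gaugeTransform p.2 (twist3 z (configPerm (Equiv.swap (0 : Fin 3) 1) (p.1 0))))))
          ∂((Measure.pi fun _ : Fin (n + 1) => configMeasure SU2 L).prod (gaugeMeasure L)) :=
      funext fun b => integral_congr_ae (ae_of_all _ fun p => swapSeamChain_eq_exp b n z p)
    rw [hfun']
    exact h
  have hfun : (fun b : ℝ => twistTraceSucc L b n) = fun b : ℝ => (1 / 8 : ℝ) * ∑ z : Fin 3 → Bool,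
      ∫ p : (Fin (n + 1) → GaugeConfig 3 L SU2) × (Site 3 L → SU2),
        (∏ i : Fin n, transferKernel su2Rep b (p.1 i.castSucc) (p.1 i.succ)) *
          transferKernel su2Rep b (p.1 (Fin.last n)) (gaugeTransform p.2 (twist3 z (configPerm (Equiv.swap (0 : Fin 3) 1) (p.1 0))))
        ∂((Measure.pi fun _ : Fin (n + 1) => configMeasure SU2 L).prod (gaugeMeasure L)) :=
    funext fun b => twistTraceSucc_eq_sum_integral_prod b n
  rw [hfun]
  exact (Differentiable.fun_sum fun z _ => hterm z).const_mul _

/-- ★ **`Z^S` is strictly positive** (from its ring-integral form, not from the signed spectral sum). [cite: tHooft1979] -/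
theorem twistTraceSucc_pos (b : ℝ) (n : ℕ) : 0 < twistTraceSucc L b n := by
  haveI := isProbabilityMeasure_gaugeMeasure (L := L)
  rw [twistTraceSucc_eq_sum_integral_prod]
  refine mul_pos (by norm_num) (Finset.sum_pos (fun z _ => ?_) Finset.univ_nonempty)
  obtain ⟨B, hB⟩ := exists_abs_log_swapSeamChain_one_le (L := L) n z
  have h := integral_exp_mul_pos ((Measure.pi fun _ : Fin (n + 1) => configMeasure SU2 L).prod (gaugeMeasure L))
    (measurable_swapSeamChain (L := L) 1 n z).log hB b
  refine h.trans_le (le_of_eq (integral_congr_ae (ae_of_all _ fun p => (swapSeamChain_eq_exp b n z p).symm)))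

/-! ## §3 The untwisted ring trace via the sector decomposition -/

/-- ★ **`Z_phys` is differentiable in the coupling** (`Z_phys = (1/8) Σ_z W_z`). [cite: MontvayMunster1994, (3.145)] -/
theorem differentiable_physTraceSucc (n : ℕ) : Differentiable ℝ (fun b : ℝ => physTraceSucc L b n) := by
  have hfun : (fun b : ℝ => physTraceSucc L b n) =
      fun b : ℝ => (1 / 8 : ℝ) * ∑ z : Fin 3 → Bool, sectorWeight (L := L) b n z (fun _ _ => (1 : ℝ)) :=
    funext fun b => physTraceSucc_eq_sum_sectorWeight b n
  rw [hfun]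
  exact (Differentiable.fun_sum fun z _ => differentiable_sectorWeight_one n z).const_mul _

/-- ★ **`Z_phys` is strictly positive.** [cite: MontvayMunster1994, (3.145)] -/
theorem physTraceSucc_pos' (b : ℝ) (n : ℕ) : 0 < physTraceSucc L b n := by
  rw [physTraceSucc_eq_sum_sectorWeight]
  exact mul_pos (by norm_num) (Finset.sum_pos (fun z _ => sectorWeight_one_pos b n z) Finset.univ_nonempty)

end Summit.QuantumFields.YangMills.Theorems.FemtoTransferGap.TT.SectorSmooth

/-! ## §4 The item, by name -/

namespace Summit.QuantumFields.YangMills.Theorems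

open Summit.QuantumFields.YangMills.Theorems.FemtoTransferGap.TT
open Summit.QuantumFields.YangMills.Theorems.FemtoTransferGap.TT.SectorSmooth

/-- ★★ **`RingTraceSmooth` holds** (item stmt-QuantumFields-24135 of route `SwapVirialDeficit`, BY NAME): for every `L`, `T` the ring traces
`b ↦ TT.physTrace L b T` and `b ↦ TT.twistTrace L b T` are differentiable on `ℝ` and strictly positive.  No crux / rung / summit is proved;
the YM mass gap is NOT proved. [cite: MontvayMunster1994, (3.145)] [cite: tHooft1979] -/
theorem swapVirialDeficit_ringTraceSmooth_proof :
    Summit.QuantumFields.YangMills.Theses.SwapVirialDeficit.RingTraceSmooth := by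
  intro L _ T
  refine ⟨differentiable_physTraceSucc (T - 1), differentiable_twistTraceSucc (T - 1), fun b => ⟨physTraceSucc_pos' b (T - 1), twistTraceSucc_pos b (T - 1)⟩⟩

end Summit.QuantumFields.YangMills.Theorems

end
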